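import Summits.HodgeConjecture.HodgeConjecture.Theorems.Ring2AbelianAllAndreLiebermanCorrespondenceAlgebra
import Literature.AlgebraicGeometry.HodgeTheory.ComplexGysinOrientation
import Literature.AlgebraicGeometry.HodgeTheory.ComplexOrientationFamily
import Literature.AlgebraicTopology.SingularHomology.GysinMapOrientationChange
import HarnessLib

/-!
# Ring 2 · sub-cell AbelianAll, André axis, part XXII-e — ALGEBRAIC CORRESPONDENCES ON THE REAL CARRIERS FORM A
# `ℂ`-LINEAR CATEGORY: the `IsAlgebraicCorrespondence` predicate is closed under composition, sums and scalars

HONEST FRAMING (page 1, verbatim): **research route, not a corollary; conditional on HC_CM plus one named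
minimal statement.** Cell line: research route conditional on HC_CM; not a corollary; Q11.4-sentence-2
already refuted in dim ≥ 3. Nothing in this file proves a case of the Hodge conjecture; `HC_CM` does not occur.
Seat `pub-hodge-ring2-ab-andre-2`, gen 14. A by-product of the Lieberman discharge (parts XXII-a–d), recorded because
several crux files of the summit note its absence ("no `IsAlgebraicCorrespondence.comp` exists on the carriers"):
the tree's predicate `IsAlgebraicCorrespondence m n W X T` (André 1996 §2.1: `T` is induced by an algebraic class on
`W × X`, for SOME Poincaré-duality orientations) is

* §1 NORMALISED: every witness can be moved to the complex orientations — `T = corrAction complexOrientationFamily hW hX hab γ`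
  with `γ` algebraic (`IsAlgebraicCorrespondence.exists_eq_corrAction`; two orientations of the closed connected manifold
  `W(ℂ)`, resp. `(W ⊗ X)(ℂ)`, differ by a unit, Hatcher Thm. 3.26, and the Gysin homomorphism changes by the quotient of
  the units, Fulton App. B (5), the tree's `gysinMap_eq_smul_of_fundamentalClass_eq`);
* §2 closed under COMPOSITION (`IsAlgebraicCorrespondence.comp`, part XXII-b `corrAction_comp`: Fulton 16.1.1 with Gysin base
  change and Voisin II Prop. 9.20, tree theorems), under precomposition with Lefschetz operators of algebraic classes
  (`IsAlgebraicCorrespondence.comp_lefschetzPow`);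
* §3 closed under SUMS and SCALARS (`.add`, `.smul`, `.neg`, `.sub`, `.sum`), and contains `0` (`isAlgebraicCorrespondence_zero`).

## What is proved (theorems only; no definition, no named fact, no sorry)

EDGE LABELS: all K. References: Andre1996Motifs (§2.1 p. 14); Fulton1998 (§16.1 Def. 16.1.1–2, Prop. 16.1.1);
VoisinHodgeII2003 (§9.2.4 Prop. 9.20–9.21, proof of Thm. 10.17 (10.7)); FultonYoungTableaux1997 (App. B §B.1 (5));
HatcherAT2002 (§3.3 Thm. 3.26); Kleiman1968AlgebraicCycles (§1.3).
-/

noncomputable section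

set_option linter.dupNamespace false

namespace Summit.HodgeConjecture.HodgeConjecture.Ring2.AbelianAll

open CategoryTheory AlgebraicGeometry MonoidalCategory CartesianMonoidalCategory
open Literature.AlgebraicGeometry Literature.AlgebraicGeometry.Motives
open Literature.AlgebraicGeometry.HodgeTheory
open Literature.AlgebraicTopology.SingularHomology (singularCohomology cupProduct gysinMap HomologicalOrientation
  gysinMap_eq_smul_of_fundamentalClass_eq)
open Literature.Geometry.Kaehler (lefschetzPow)

variable {l m n : ℕ} {W X Y Z : SchemeOver ℂ}

/-! ## §1 Normalisation to the complex orientations -/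

/-- **Every algebraic correspondence is `[γ]_*` for the COMPLEX orientations.** If `T : Hᵃ(X(ℂ)) → Hᵇ(W(ℂ))` is induced by
an algebraic class for some Poincaré-duality orientations `μ` of `(W ⊗ X)(ℂ)` and `ν` of `W(ℂ)`, then
`T = corrAction complexOrientationFamily hW hX hab γ` for an algebraic `γ` of the same codimension: `[M]_μ = u_μ [M]`,
`[W]_ν = u_ν [W]` with units `u` (closed connected manifolds), so `pr_{W*}^{μ,ν} = (u_ν⁻¹ u_μ) pr_{W*}` and the scalar is
absorbed into `γ`. [cite: HatcherAT2002, §3.3 Thm. 3.26] [cite: FultonYoungTableaux1997, Appendix B §B.1 (5)]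
[cite: Andre1996Motifs, §2.1 remark following Déf. 1 (p. 14)] -/
theorem IsAlgebraicCorrespondence.exists_eq_corrAction (hW : IsSmoothProjective m W) (hX : IsSmoothProjective n X)
    {a b : ℕ} {T : complexBetti X a →ₗ[ℂ] complexBetti W b} (h : IsAlgebraicCorrespondence m n W X T) :
    ∃ (e : ℕ) (hab : a + 2 * e = b + 2 * n) (γ : complexBetti (W ⊗ X) (2 * e)),
      γ ∈ algebraicClasses (W ⊗ X) e ∧ T = corrAction complexOrientationFamily hW hX hab γ := by
  obtain ⟨μ, ν, hμ, hν, e, q, hab, hq, γ, hγ, hT⟩ := h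
  have hWX : IsSmoothProjective (m + n) (W ⊗ X) := hW.tensor_holds hX
  -- the two pairs of orientations differ by units
  obtain ⟨uM, huM⟩ : ∃ u : ℂˣ, μ.fundamentalClass = (u : ℂ) • (complexOrientationFamily hWX).fundamentalClass := by
    letI := hWX.chartedSpace
    haveI := ComplexPoints.compactSpace_of_isSmoothProjective hWX
    haveI := ComplexPoints.t2Space_of_isSmoothProjective hWX
    haveI := connectedSpace_complexPoints hWX
    obtain ⟨u, hu, -⟩ := (complexOrientationFamily hWX).exists_unit_fundamentalClass_eq_smul μ
    exact ⟨u, hu⟩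
  obtain ⟨uW, huW⟩ : ∃ u : ℂˣ, ν.fundamentalClass = (u : ℂ) • (complexOrientationFamily hW).fundamentalClass := by
    letI := hW.chartedSpace
    haveI := ComplexPoints.compactSpace_of_isSmoothProjective hW
    haveI := ComplexPoints.t2Space_of_isSmoothProjective hW
    haveI := connectedSpace_complexPoints hW
    obtain ⟨u, hu, -⟩ := (complexOrientationFamily hW).exists_unit_fundamentalClass_eq_smul ν
    exact ⟨u, hu⟩
  set c : ℂ := (uW : ℂ)⁻¹ * (uM : ℂ) with hc
  have hgysin : gysinMap μ ν (AlgPoints.mapContinuous (L := ℂ) (fst W X))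
        (show a + 2 * e + q = 2 * (m + n) by omega) hq =
      c • gysinMap (complexOrientationFamily hWX) (complexOrientationFamily hW)
        (AlgPoints.mapContinuous (L := ℂ) (fst W X)) (show a + 2 * e + q = 2 * (m + n) by omega) hq :=
    gysinMap_eq_smul_of_fundamentalClass_eq (hasPoincareDuality_complexOrientationFamily hW) hν huM huW
      (by rw [hc, ← mul_assoc, mul_inv_cancel₀ uW.ne_zero, one_mul]) _ _ _
  refine ⟨e, hab, c • γ, Submodule.smul_mem _ _ hγ, ?_⟩
  rw [← hT, map_smul, corrAction_eq_corrClassAction complexOrientationFamily hW hX hab hq]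
  refine LinearMap.ext fun x ↦ ?_
  rw [LinearMap.smul_apply, corrClassAction_apply, corrClassAction_apply, hgysin, LinearMap.smul_apply]

/-- Converse packaging: `corrAction complexOrientationFamily hW hX hab γ` with `γ` algebraic IS an algebraic correspondence
(the tree's `isAlgebraicCorrespondence_corrAction`, with the auxiliary degree `q = 2m − b` supplied; `b ≤ 2m` is automatic when
`Hᵇ(W(ℂ)) ≠ 0`, and assumed here). [cite: Andre1996Motifs, §2.1 remark following Déf. 1 (p. 14)] -/
theorem isAlgebraicCorrespondence_corrAction_complex (hW : IsSmoothProjective m W) (hX : IsSmoothProjective n X)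
    {e a b : ℕ} (hab : a + 2 * e = b + 2 * n) (hb : b ≤ 2 * m) {γ : complexBetti (W ⊗ X) (2 * e)}
    (hγ : γ ∈ algebraicClasses (W ⊗ X) e) :
    IsAlgebraicCorrespondence m n W X (corrAction complexOrientationFamily hW hX hab γ) :=
  isAlgebraicCorrespondence_corrAction complexOrientationFamily hasPoincareDuality_complexOrientationFamily hW hX hab
    (show b + (2 * m - b) = 2 * m by omega) hγ

/-- The auxiliary degree inequality `b ≤ 2 dim W` holds for every algebraic correspondence into `Hᵇ(W(ℂ))` (it is part of the
witness). [folklore] -/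
theorem IsAlgebraicCorrespondence.le_two_mul {a b : ℕ} {T : complexBetti X a →ₗ[ℂ] complexBetti W b}
    (h : IsAlgebraicCorrespondence m n W X T) : b ≤ 2 * m := by
  obtain ⟨_, _, _, _, _, q, _, hq, _⟩ := h
  omega

/-! ## §2 Composition -/

/-- **Composition of algebraic correspondences is an algebraic correspondence** (Fulton Def. 16.1.1 / Prop. 16.1.1 on the
real carriers): for smooth projective `X, Y, Z` of dimensions `l, m, n`, if `T' : Hᵃ(Z(ℂ)) → H^{a₁}(Y(ℂ))` and
`T : H^{a₁}(Y(ℂ)) → H^{a₂}(X(ℂ))` are induced by algebraic classes, so is `T ∘ T'` (degree proviso `a ≤ a₂ + 2n`, automatic for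
`a ≤ 2 dim Z`). Proof: normalise both to the complex orientations (§1) and compose the classes (part XXII-b `corrAction_comp`:
`γ'' = c • p₁₃_*(p₁₂^*γ ∪ p₂₃^*γ')`, algebraic by Gysin base change and Voisin II Prop. 9.20).
[cite: Fulton1998, §16.1 Def. 16.1.1 and Prop. 16.1.1] [cite: VoisinHodgeII2003, §9.2.4 Prop. 9.20 and Prop. 9.21]
[cite: Andre1996Motifs, §2.1 (p. 14)] -/
theorem IsAlgebraicCorrespondence.comp (hX : IsSmoothProjective l X) (hY : IsSmoothProjective m Y)
    (hZ : IsSmoothProjective n Z) {a a₁ a₂ : ℕ} {T' : complexBetti Z a →ₗ[ℂ] complexBetti Y a₁}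
    {T : complexBetti Y a₁ →ₗ[ℂ] complexBetti X a₂} (hT' : IsAlgebraicCorrespondence m n Y Z T')
    (hT : IsAlgebraicCorrespondence l m X Y T) (ha : a ≤ a₂ + 2 * n) :
    IsAlgebraicCorrespondence l n X Z (T ∘ₗ T') := by
  have hb := IsAlgebraicCorrespondence.le_two_mul hT
  obtain ⟨e', h₁, γ', hγ', rfl⟩ := IsAlgebraicCorrespondence.exists_eq_corrAction hY hZ hT'
  obtain ⟨e, h₂, γ, hγ, rfl⟩ := IsAlgebraicCorrespondence.exists_eq_corrAction hX hY hT
  obtain ⟨e'', he⟩ : ∃ e'' : ℕ, e + e' = e'' + m := ⟨e + e' - m, by omega⟩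
  obtain ⟨γ'', hγ'', h''⟩ := corrAction_comp complexOrientationFamily hX hY hZ he h₁ h₂
    (show a + 2 * e'' = a₂ + 2 * n by omega) hγ hγ'
  rw [← h'']
  exact isAlgebraicCorrespondence_corrAction_complex hX hZ _ hb hγ''

/-- **Precomposition with a Lefschetz power of an algebraic class keeps a correspondence algebraic**:
`T ∘ Lʳ_η` for `η ∈ N¹ H²(X(ℂ))` (part XXII-b `corrAction_comp_lefschetzPow`: the class is `pr_X^* ηʳ ∪ γ`).
[cite: VoisinHodgeII2003, §9.2.4 Prop. 9.20 and proof of Thm. 10.17 (10.7)] -/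
theorem IsAlgebraicCorrespondence.comp_lefschetzPow (hW : IsSmoothProjective m W) (hX : IsSmoothProjective n X)
    {η : complexBetti X 2} (hη : η ∈ algebraicClasses X 1) (a r : ℕ) {b : ℕ}
    {T : complexBetti X (a + 2 * r) →ₗ[ℂ] complexBetti W b} (hT : IsAlgebraicCorrespondence m n W X T) :
    IsAlgebraicCorrespondence m n W X (T ∘ₗ lefschetzPow η r a) := by
  have hb := IsAlgebraicCorrespondence.le_two_mul hT
  obtain ⟨e, hab, γ, hγ, rfl⟩ := IsAlgebraicCorrespondence.exists_eq_corrAction hW hX hT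
  obtain ⟨γ', hγ', h'⟩ := corrAction_comp_lefschetzPow complexOrientationFamily hW hX hη a r (e := e) (e' := e + r) rfl
    hab (show a + 2 * (e + r) = b + 2 * n by omega) hγ
  have heq : corrAction complexOrientationFamily hW hX hab γ ∘ₗ lefschetzPow η r a =
      corrAction complexOrientationFamily hW hX (show a + 2 * (e + r) = b + 2 * n by omega) γ' :=
    LinearMap.ext fun x ↦ by rw [LinearMap.comp_apply, h' x]
  rw [heq]
  exact isAlgebraicCorrespondence_corrAction_complex hW hX _ hb hγ'

/-! ## §3 Sums and scalars -/

/-- **The zero map is an algebraic correspondence** (class `0`), in every pair of degrees admitting a codimension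
(`a + 2e = b + 2 dim X`, `b ≤ 2 dim W`). [cite: Andre1996Motifs, §2.1 (p. 14)] -/
theorem isAlgebraicCorrespondence_zero (hW : IsSmoothProjective m W) (hX : IsSmoothProjective n X) {e a b : ℕ}
    (hab : a + 2 * e = b + 2 * n) (hb : b ≤ 2 * m) :
    IsAlgebraicCorrespondence m n W X (0 : complexBetti X a →ₗ[ℂ] complexBetti W b) := by
  have h := isAlgebraicCorrespondence_corrAction_complex hW hX hab hb (Submodule.zero_mem (algebraicClasses (W ⊗ X) e))
  rwa [map_zero] at h

/-- **Scalar multiples of algebraic correspondences are algebraic correspondences** (`algebraicClasses` is a `ℂ`-subspace).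
[cite: Andre1996Motifs, §2.1 (p. 14)] -/
theorem IsAlgebraicCorrespondence.smul (hW : IsSmoothProjective m W) (hX : IsSmoothProjective n X) {a b : ℕ}
    {T : complexBetti X a →ₗ[ℂ] complexBetti W b} (hT : IsAlgebraicCorrespondence m n W X T) (c : ℂ) :
    IsAlgebraicCorrespondence m n W X (c • T) := by
  have hb := IsAlgebraicCorrespondence.le_two_mul hT
  obtain ⟨e, hab, γ, hγ, rfl⟩ := IsAlgebraicCorrespondence.exists_eq_corrAction hW hX hT
  rw [← map_smul]
  exact isAlgebraicCorrespondence_corrAction_complex hW hX hab hb (Submodule.smul_mem _ _ hγ)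

/-- **Sums of algebraic correspondences (same degrees) are algebraic correspondences.** The two codimensions agree
(`a + 2e = b + 2n` determines `e`), and `corrAction` is additive in the class. [cite: Andre1996Motifs, §2.1 (p. 14)] -/
theorem IsAlgebraicCorrespondence.add (hW : IsSmoothProjective m W) (hX : IsSmoothProjective n X) {a b : ℕ}
    {T₁ T₂ : complexBetti X a →ₗ[ℂ] complexBetti W b} (h₁ : IsAlgebraicCorrespondence m n W X T₁)
    (h₂ : IsAlgebraicCorrespondence m n W X T₂) : IsAlgebraicCorrespondence m n W X (T₁ + T₂) := by
  have hb := IsAlgebraicCorrespondence.le_two_mul h₁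
  obtain ⟨e₁, hab₁, γ₁, hγ₁, rfl⟩ := IsAlgebraicCorrespondence.exists_eq_corrAction hW hX h₁
  obtain ⟨e₂, hab₂, γ₂, hγ₂, rfl⟩ := IsAlgebraicCorrespondence.exists_eq_corrAction hW hX h₂
  obtain rfl : e₁ = e₂ := by omega
  rw [← map_add]
  exact isAlgebraicCorrespondence_corrAction_complex hW hX hab₁ hb (Submodule.add_mem _ hγ₁ hγ₂)

/-- Negatives of algebraic correspondences are algebraic correspondences. [cite: Andre1996Motifs, §2.1 (p. 14)] -/
theorem IsAlgebraicCorrespondence.neg (hW : IsSmoothProjective m W) (hX : IsSmoothProjective n X) {a b : ℕ}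
    {T : complexBetti X a →ₗ[ℂ] complexBetti W b} (hT : IsAlgebraicCorrespondence m n W X T) :
    IsAlgebraicCorrespondence m n W X (-T) := by
  have h := IsAlgebraicCorrespondence.smul hW hX hT (-1)
  rwa [neg_one_smul] at h

/-- Differences of algebraic correspondences are algebraic correspondences. [cite: Andre1996Motifs, §2.1 (p. 14)] -/
theorem IsAlgebraicCorrespondence.sub (hW : IsSmoothProjective m W) (hX : IsSmoothProjective n X) {a b : ℕ}
    {T₁ T₂ : complexBetti X a →ₗ[ℂ] complexBetti W b} (h₁ : IsAlgebraicCorrespondence m n W X T₁)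
    (h₂ : IsAlgebraicCorrespondence m n W X T₂) : IsAlgebraicCorrespondence m n W X (T₁ - T₂) := by
  rw [sub_eq_add_neg]
  exact IsAlgebraicCorrespondence.add hW hX h₁ (IsAlgebraicCorrespondence.neg hW hX h₂)

/-- **Finite linear combinations of algebraic correspondences are algebraic correspondences** (non-empty index set, or
degrees admitting a codimension — here: a non-empty family, so that the codimension is read off a member).
[cite: Andre1996Motifs, §2.1 (p. 14)] [cite: Kleiman1968AlgebraicCycles, §1.3] -/
theorem IsAlgebraicCorrespondence.sum (hW : IsSmoothProjective m W) (hX : IsSmoothProjective n X) {a b : ℕ}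
    {ι : Type*} (s : Finset ι) (d : ι → ℂ) (T : ι → (complexBetti X a →ₗ[ℂ] complexBetti W b))
    (hT : ∀ k, IsAlgebraicCorrespondence m n W X (T k)) (k₀ : ι) :
    IsAlgebraicCorrespondence m n W X (∑ k ∈ s, d k • T k) := by
  classical
  have hb := IsAlgebraicCorrespondence.le_two_mul (hT k₀)
  obtain ⟨e, hab, -, -, -⟩ := IsAlgebraicCorrespondence.exists_eq_corrAction hW hX (hT k₀)
  induction s using Finset.induction_on with
  | empty =>
    rw [Finset.sum_empty]
    exact isAlgebraicCorrespondence_zero hW hX hab hb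
  | insert k s hk ih =>
    rw [Finset.sum_insert hk]
    exact IsAlgebraicCorrespondence.add hW hX (IsAlgebraicCorrespondence.smul hW hX (hT k) (d k)) ih

end Summit.HodgeConjecture.HodgeConjecture.Ring2.AbelianAll

end
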